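import Mathlib
import Summits.ValiantsHypothesis.ValiantsHypothesis.Theorems.RigidityForcesSymmetryRankRigidMinimalReprLaplaceFiveSeparatedCaptureK1Bridge
import Summits.ValiantsHypothesis.ValiantsHypothesis.Theorems.RigidityForcesSymmetryRankRigidMinimalReprLaplaceFiveSeparatedCaptureLines
import Summits.ValiantsHypothesis.ValiantsHypothesis.Theorems.RigidityForcesSymmetryRankRigidMinimalReprLaplaceFiveSeparatedCaptureTwoCuts

/-!
# ValiantsHypothesis / RigidityForcesSymmetry — crux `LaplaceOptimalFive` (stmt-ValiantsHypothesis-24813), young-shadow K1: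
# **K1 ON `K₃ ⊔ K₂` FOR «AT MOST ONE SHORT-FACTOR DIRECTION PER TRIANGLE CUT» — UNCONDITIONAL** (+ rôle symmetry of `L₃`)

First consumer of the local bridge ★ `sideSym_K32canon_of_captureAt` (`…SeparatedCaptureK1Bridge.lean`): a side-symmetric split
decomposition of `P₅` on `{01, 02, 12, 34}` each of whose three triangle short spans has dimension `≤ 1` — every triangle cut filed with
multiples of ONE letter matrix, or not filed at all; leaf factors and long factors arbitrary; any multiplicities; off-shell allowed — has
Laplace weight `≥ 5! = 120`.  The (SC) input is ✓ `captureIneqSym_of_lines` (val-lit-p4 g17 / val-port-2 g5: all three spans are lines)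
or ✓ `captureIneqSym_of_third_bot` (val-port-2 g5: one span is `⊥`) — the latter is stated for the THIRD cut only, so this file first
records the RÔLE SYMMETRY of the triangle configuration space `L₃(U₀₁, U₀₂, U₁₂)` for symmetric spans: a permutation of the three
tensor slots permutes the three spans (`swap12_mem_L3`, `swap13_mem_L3`), and the obligation tensor `contractZ μ`, being invariant under
all slot permutations (✓ `contractZ_swap12`, ✓ `contractZ_swap23`), is captured by `L₃` in every ordering of the spans
(`contractZ_mem_L3_swap23`, `contractZ_mem_L3_swap13`); hence `captureIneqSym_of_one_bot` (an empty cut in ANY position).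

Honest framing.  A SUB-CASE of K1 on `K₃ ⊔ K₂`; K1 on `K₃ ⊔ K₂` in general, `CaptureIneqSym`, S2′, `LaplaceOptimalFive`
(OPEN · CONTESTED 72/120), `RankRigidMinimalRepr`, `VP ≠ VNP` are NOT proved.  No definitions, no `sorry`.
-/

set_option linter.dupNamespace false
set_option autoImplicit false

namespace Summit.ValiantsHypothesis.ValiantsHypothesis.Theorems.RigidityForcesSymmetryRankRigidMinimalRepr

namespace LaplaceFiveSeparatedCapture

open Finset LaplaceFiveSectorSplit

/-! ### Rôle symmetry of `L₃` for symmetric spans, and K1 for «≤ 1 short-factor direction per triangle cut» -/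

/-- The generators of `L₃`, membership form (plumbing). [folklore] -/
theorem mem_L3_of_gen01 (U01 U02 U12 : Submodule ℂ (Fin 5 → Fin 5 → ℂ)) {u : Fin 5 → Fin 5 → ℂ} (hu : u ∈ U01)
    (y : Fin 5 → ℂ) : (fun p q r => u p q * y r) ∈ L3 U01 U02 U12 :=
  Submodule.subset_span (Or.inl (Or.inl ⟨u, hu, y, rfl⟩))

/-- The generators of `L₃`, membership form (plumbing). [folklore] -/
theorem mem_L3_of_gen02 (U01 U02 U12 : Submodule ℂ (Fin 5 → Fin 5 → ℂ)) {u : Fin 5 → Fin 5 → ℂ} (hu : u ∈ U02)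
    (y : Fin 5 → ℂ) : (fun p q r => u p r * y q) ∈ L3 U01 U02 U12 :=
  Submodule.subset_span (Or.inl (Or.inr ⟨u, hu, y, rfl⟩))

/-- The generators of `L₃`, membership form (plumbing). [folklore] -/
theorem mem_L3_of_gen12 (U01 U02 U12 : Submodule ℂ (Fin 5 → Fin 5 → ℂ)) {u : Fin 5 → Fin 5 → ℂ} (hu : u ∈ U12)
    (y : Fin 5 → ℂ) : (fun p q r => u q r * y p) ∈ L3 U01 U02 U12 :=
  Submodule.subset_span (Or.inr ⟨u, hu, y, rfl⟩)

/-- **Rôle symmetry of `L₃` under the slot transposition `(1 2)`**: for symmetric configuration spaces, swapping the first two tensor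
slots exchanges the rôles of `U₀₂` and `U₁₂`. [folklore] -/
theorem swap12_mem_L3 (U01 U02 U12 : Submodule ℂ (Fin 5 → Fin 5 → ℂ))
    (hs01 : ∀ u ∈ U01, ∀ p q : Fin 5, u p q = u q p) {T : Fin 5 → Fin 5 → Fin 5 → ℂ} (hT : T ∈ L3 U01 U02 U12) :
    (fun p q r => T q p r) ∈ L3 U01 U12 U02 := by
  unfold L3 at hT
  refine Submodule.span_induction ?_ ?_ ?_ ?_ hT
  · rintro X ((⟨u, hu, y, rfl⟩ | ⟨u, hu, y, rfl⟩) | ⟨u, hu, y, rfl⟩)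
    · have h : (fun p q r => (fun p q r => u p q * y r) q p r) = fun p q r => u p q * y r := by
        funext p q r
        simp only [hs01 u hu q p]
      rw [h]
      exact mem_L3_of_gen01 U01 U12 U02 hu y
    · exact mem_L3_of_gen12 U01 U12 U02 hu y
    · exact mem_L3_of_gen02 U01 U12 U02 hu y
  · exact Submodule.zero_mem _
  · intro X Y _ _ hX hY
    exact Submodule.add_mem _ hX hY
  · intro c X _ hX
    exact Submodule.smul_mem _ c hX

/-- **Rôle symmetry of `L₃` under the slot transposition `(1 3)`**: for symmetric configuration spaces, swapping the outer tensor slots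
exchanges the rôles of `U₀₁` and `U₁₂`. [folklore] -/
theorem swap13_mem_L3 (U01 U02 U12 : Submodule ℂ (Fin 5 → Fin 5 → ℂ))
    (hs01 : ∀ u ∈ U01, ∀ p q : Fin 5, u p q = u q p) (hs02 : ∀ u ∈ U02, ∀ p q : Fin 5, u p q = u q p)
    (hs12 : ∀ u ∈ U12, ∀ p q : Fin 5, u p q = u q p) {T : Fin 5 → Fin 5 → Fin 5 → ℂ} (hT : T ∈ L3 U01 U02 U12) :
    (fun p q r => T r q p) ∈ L3 U12 U02 U01 := by
  unfold L3 at hT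
  refine Submodule.span_induction ?_ ?_ ?_ ?_ hT
  · rintro X ((⟨u, hu, y, rfl⟩ | ⟨u, hu, y, rfl⟩) | ⟨u, hu, y, rfl⟩)
    · have h : (fun p q r => (fun p q r => u p q * y r) r q p) = fun p q r => u q r * y p := by
        funext p q r
        simp only [hs01 u hu r q]
      rw [h]
      exact mem_L3_of_gen12 U12 U02 U01 hu y
    · have h : (fun p q r => (fun p q r => u p r * y q) r q p) = fun p q r => u p r * y q := by
        funext p q r
        simp only [hs02 u hu r p]
      rw [h]
      exact mem_L3_of_gen02 U12 U02 U01 hu y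
    · have h : (fun p q r => (fun p q r => u q r * y p) r q p) = fun p q r => u p q * y r := by
        funext p q r
        simp only [hs12 u hu q p]
      rw [h]
      exact mem_L3_of_gen01 U12 U02 U01 hu y
  · exact Submodule.zero_mem _
  · intro X Y _ _ hX hY
    exact Submodule.add_mem _ hX hY
  · intro c X _ hX
    exact Submodule.smul_mem _ c hX

/-- The obligation tensor is invariant under every slot permutation; hence its capture by `L₃` is insensitive to the ORDER of the three
symmetric configuration spaces: `(U₀₁, U₀₂, U₁₂) → (U₀₁, U₁₂, U₀₂)`. [folklore] -/
theorem contractZ_mem_L3_swap23 (U01 U02 U12 : Submodule ℂ (Fin 5 → Fin 5 → ℂ))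
    (hs01 : ∀ u ∈ U01, ∀ p q : Fin 5, u p q = u q p) (μ : Fin 5 → Fin 5 → ℂ)
    (h : contractZ μ ∈ L3 U01 U02 U12) : contractZ μ ∈ L3 U01 U12 U02 := by
  have e : (fun p q r => contractZ μ q p r) = contractZ μ := by
    funext p q r
    exact contractZ_swap12 μ p q r
  rw [← e]
  exact swap12_mem_L3 U01 U02 U12 hs01 h

/-- … and `(U₀₁, U₀₂, U₁₂) → (U₁₂, U₀₂, U₀₁)`. [folklore] -/
theorem contractZ_mem_L3_swap13 (U01 U02 U12 : Submodule ℂ (Fin 5 → Fin 5 → ℂ))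
    (hs01 : ∀ u ∈ U01, ∀ p q : Fin 5, u p q = u q p) (hs02 : ∀ u ∈ U02, ∀ p q : Fin 5, u p q = u q p)
    (hs12 : ∀ u ∈ U12, ∀ p q : Fin 5, u p q = u q p) (μ : Fin 5 → Fin 5 → ℂ)
    (h : contractZ μ ∈ L3 U01 U02 U12) : contractZ μ ∈ L3 U12 U02 U01 := by
  have e : (fun p q r => contractZ μ r q p) = contractZ μ := by
    funext p q r
    rw [← contractZ_swap23 μ r q p, ← contractZ_swap12 μ r p q, ← contractZ_swap23 μ p r q]
  rw [← e]
  exact swap13_mem_L3 U01 U02 U12 hs01 hs02 hs12 h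

/-- **`CaptureIneqSym` WITH ONE EMPTY TRIANGLE CUT, ANY POSITION** (✓ `captureIneqSym_of_third_bot` moved to the cut `{0,2}` or `{0,1}` by
rôle symmetry). [folklore] -/
theorem captureIneqSym_of_one_bot (U01 U02 U12 W : Submodule ℂ (Fin 5 → Fin 5 → ℂ))
    (hs01 : ∀ u ∈ U01, ∀ p q : Fin 5, u p q = u q p) (hs02 : ∀ u ∈ U02, ∀ p q : Fin 5, u p q = u q p)
    (hs12 : ∀ u ∈ U12, ∀ p q : Fin 5, u p q = u q p) (hbot : U01 = ⊥ ∨ U02 = ⊥ ∨ U12 = ⊥)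
    (hWs : ∀ μ ∈ W, ∀ s t : Fin 5, μ s t = μ t s) (hWd : ∀ μ ∈ W, ∀ s : Fin 5, μ s s = 0)
    (hWc : ∀ μ ∈ W, contractZ μ ∈ L3 U01 U02 U12) :
    Module.finrank ℂ W ≤ Module.finrank ℂ U01 + Module.finrank ℂ U02 + Module.finrank ℂ U12 := by
  rcases hbot with h | h | h
  · -- `U₀₁ = ⊥`: read the capture as `L3 U12 U02 ⊥`
    subst h
    have h' := captureIneqSym_of_third_bot U12 U02 W hs12 hs02 hWs hWd fun μ hμ =>
      contractZ_mem_L3_swap13 ⊥ U02 U12 (fun u hu => by simp [(Submodule.mem_bot ℂ).1 hu]) hs02 hs12 μ (hWc μ hμ)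
    simp only [finrank_bot, zero_add]
    omega
  · -- `U₀₂ = ⊥`: read the capture as `L3 U01 U12 ⊥`
    subst h
    have h' := captureIneqSym_of_third_bot U01 U12 W hs01 hs12 hWs hWd fun μ hμ =>
      contractZ_mem_L3_swap23 U01 ⊥ U12 hs01 μ (hWc μ hμ)
    simp only [finrank_bot, add_zero]
    omega
  · subst h
    have h' := captureIneqSym_of_third_bot U01 U02 W hs01 hs02 hWs hWd hWc
    simp only [finrank_bot, add_zero]
    exact h'

/-- A symmetric span of dimension `≤ 1` is `⊥` or a line through a nonzero symmetric matrix (plumbing). [folklore] -/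
theorem eq_bot_or_line_of_finrank_le_one (U : Submodule ℂ (Fin 5 → Fin 5 → ℂ)) (hU : Module.finrank ℂ U ≤ 1) :
    U = ⊥ ∨ ∃ u : Fin 5 → Fin 5 → ℂ, u ≠ 0 ∧ u ∈ U ∧ U = ℂ ∙ u := by
  rcases Nat.lt_or_ge (Module.finrank ℂ U) 1 with h0 | h1
  · left
    exact Submodule.finrank_eq_zero.mp (by omega)
  · right
    have h1' : Module.finrank ℂ U = 1 := le_antisymm hU h1
    obtain ⟨v, hv, hspan⟩ := finrank_eq_one_iff'.mp h1'
    refine ⟨(v : Fin 5 → Fin 5 → ℂ), fun h => hv (Subtype.ext h), v.2, ?_⟩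
    apply le_antisymm
    · intro x hx
      obtain ⟨c, hc⟩ := hspan ⟨x, hx⟩
      rw [Submodule.mem_span_singleton]
      exact ⟨c, by simpa using congrArg Subtype.val hc⟩
    · rw [Submodule.span_singleton_le_iff_mem]
      exact v.2

/-- ★★ **K1 ON `K₃ ⊔ K₂` FOR «AT MOST ONE SHORT-FACTOR DIRECTION PER TRIANGLE CUT» — UNCONDITIONAL.**  A side-symmetric split
decomposition of `P₅` on `{01, 02, 12, 34}` each of whose three triangle short spans has dimension `≤ 1` (every triangle cut filed with
multiples of ONE letter matrix, or not filed at all; leaf factors and long factors arbitrary) has Laplace weight `≥ 5! = 120`: the local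
bridge ★ `sideSym_K32canon_of_captureAt` fed by ✓ `captureIneqSym_of_lines` (three lines) or ✓ `captureIneqSym_of_third_bot` (an empty
cut, moved into place by rôle symmetry). [folklore] -/
theorem sideSym_K32canon_lines {N : ℕ} (T : Finset (Fin N)) (S : Fin N → Finset (Fin 5))
    (u w : Fin N → (Fin 5 → Fin 5) → ℂ) (hdec : IsSplitDecomposition T S u w) (hsym : SideSymmetric T S u w)
    (hC : ∀ t ∈ T, S t = ({0, 1} : Finset (Fin 5)) ∨ S t = ({0, 2} : Finset (Fin 5)) ∨
      S t = ({1, 2} : Finset (Fin 5)) ∨ S t = ({3, 4} : Finset (Fin 5)))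
    (h01 : Module.finrank ℂ (shortSpan T S u 0 1) ≤ 1) (h02 : Module.finrank ℂ (shortSpan T S u 0 2) ≤ 1)
    (h12 : Module.finrank ℂ (shortSpan T S u 1 2) ≤ 1) :
    Nat.factorial 5 ≤ laplaceWeight T S := by
  refine sideSym_K32canon_of_captureAt T S u w hdec hsym hC fun hs01 hs02 hs12 W hWs hWd hWc => ?_
  rcases eq_bot_or_line_of_finrank_le_one _ h01 with hb1 | ⟨u₁, hn₁, -, he₁⟩
  · exact captureIneqSym_of_one_bot _ _ _ W hs01 hs02 hs12 (Or.inl hb1) hWs hWd hWc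
  rcases eq_bot_or_line_of_finrank_le_one _ h02 with hb2 | ⟨u₂, hn₂, -, he₂⟩
  · exact captureIneqSym_of_one_bot _ _ _ W hs01 hs02 hs12 (Or.inr (Or.inl hb2)) hWs hWd hWc
  rcases eq_bot_or_line_of_finrank_le_one _ h12 with hb3 | ⟨u₃, hn₃, -, he₃⟩
  · exact captureIneqSym_of_one_bot _ _ _ W hs01 hs02 hs12 (Or.inr (Or.inr hb3)) hWs hWd hWc
  have hu₁ : ∀ p q, u₁ p q = u₁ q p := fun p q => hs01 u₁ (by rw [he₁]; exact Submodule.mem_span_singleton_self u₁) p q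
  have hu₂ : ∀ p q, u₂ p q = u₂ q p := fun p q => hs02 u₂ (by rw [he₂]; exact Submodule.mem_span_singleton_self u₂) p q
  have hu₃ : ∀ p q, u₃ p q = u₃ q p := fun p q => hs12 u₃ (by rw [he₃]; exact Submodule.mem_span_singleton_self u₃) p q
  exact captureIneqSym_of_lines u₁ u₂ u₃ hu₁ hu₂ hu₃ hn₁ hn₂ hn₃ _ _ _ W he₁ he₂ he₃ hWs hWd hWc

end LaplaceFiveSeparatedCapture

end Summit.ValiantsHypothesis.ValiantsHypothesis.Theorems.RigidityForcesSymmetryRankRigidMinimalRepr
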